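import Summits.NavierStokesRegularity.NavierStokesRegularity.Theorems.SqueezeCycleSingularProfileOfNontrivialPressureIdentification
import Summits.NavierStokesRegularity.NavierStokesRegularity.Theorems.SqueezeCycleSingularProfileOfNontrivialPressureOscillation
import Summits.NavierStokesRegularity.NavierStokesRegularity.Theorems.SqueezeCycleSingularProfileOfNontrivialUnitBallEnergy

/-!
# Route SqueezeCycle · item `SingularProfileOfNontrivial` (stmt-NavierStokesRegularity-15368):
# `𝐈(ℝ³ × ℝ₋) < ∞` for every member of the Type-I model class 𝒦_C

Helper file (theorems only) — the heart of the bridge 𝒦_C → Albritton–Barker's local-energy class.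
For `u ∈ 𝒦_C` and ANY classical pressure `q` on `(−∞,0)`: `q(t) = Q[u(t)] + c(t)` (the Morrey-class
pressure identification on windows `[t−1, t/2]`), hence `D(Q(0,1)) ≤ K_D(C)` (the mean-free quantity sees
only `Q[u(t)]`; slice oscillation bound, `∫_{B(0,3)}|u(t)|³ ≤ 3C²(−t)^{−1/2}`, Tonelli), and with
`A ≤ C`, `C ≤ 2C²`, `E ≤ 3C` and the scale covariance of the four quantities (`abScaledSum_nsZoom`) under the
class-preserving zooms (`modelClass_zoom`), `typeIBound (Iio 0 ×ˢ univ) u q ∇u < ⊤`. This is the input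
`𝐈 < ∞` that Albritton–Barker 2019, Thm 1.1 assumes and that the bare sup-rate class lacks (A–B Rem. 3.2).

References: T. Tao, Anal. PDE 6 (2013), §4, proof of Lemma 4.1 (i) [Tao2011]; D. Albritton, T. Barker,
J. Math. Fluid Mech. 21 (2019) = arXiv:1811.00502, §1, §3 [AlbrittonBarker2019]; G. Koch, N. Nadirashvili,
G. Seregin, V. Šverák, Acta Math. 203 (2009) [KochNadirashviliSereginSverak2009].
-/

noncomputable section

-- the sub-problem namespace repeats the summit name (D-0017 layout `Summit.<S>.<P>.Theorems`)
set_option linter.dupNamespace false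
-- nested operator types `ℝ³ →L[ℝ] ℝ³ →L[ℝ] ℝ³ →L[ℝ] ℝ` (pressure kernels)
set_option maxSynthPendingDepth 3

namespace Summit.NavierStokesRegularity.NavierStokesRegularity.Theorems.SingularProfile

open MeasureTheory Set Filter Metric Function
open _root_.Topology
open scoped ENNReal NNReal Laplacian ContDiff RealInnerProductSpace
open Literature.Analysis.FluidPDE
open Literature.Analysis.FluidPDE.FourierNS (HasDecay)

variable {C : ℝ} {u : ℝ → (EuclideanSpace ℝ (Fin 3)) → (EuclideanSpace ℝ (Fin 3))}
  {q : ℝ → (EuclideanSpace ℝ (Fin 3)) → ℝ}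

/-- **The pressure of a class member is the Riesz pressure up to a function of time**:
for `u ∈ 𝒦_C` and ANY classical pressure `q` on `(−∞, 0)`, `q(t,x) = Q[u(t)](x) + c(t)` with
`c(t) = q(t,0) − Q[u(t)](0)` (`pressure_sub_pressurePotential_eq_morrey` on the window
`[t−1, t/2]` translated to `[0, T]`; the Morrey bound is `morrey_of_energyClause`).
[cite: Tao2011, §4, proof of Lemma 4.1 (i)] -/
theorem pressure_eq_pressurePotential_add (hK : IsTypeIAncientMild C u)
    (h5 : ∀ (x₀ : EuclideanSpace ℝ (Fin 3)) (t₀ r : ℝ), t₀ ≤ 0 → 0 < r →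
      (∀ t, t₀ - r ^ 2 < t → t < t₀ → r⁻¹ * ∫ x in ball x₀ r, ‖u t x‖ ^ 2 ≤ C) ∧
        r⁻¹ * ∫ t in Ioo (t₀ - r ^ 2) t₀, ∫ x in ball x₀ r, ‖fderiv ℝ (u t) x‖ ^ 2 ≤ C)
    (hq : IsClassicalNSSolutionOn (Iio 0) 1 0 u q) {t : ℝ} (ht : t < 0)
    (x : EuclideanSpace ℝ (Fin 3)) :
    q t x = pressurePotential (u t) x + (q t 0 - pressurePotential (u t) 0) := by
  set t₁ : ℝ := t - 1 with ht₁
  set t₂ : ℝ := t / 2 with ht₂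
  set T : ℝ := t₂ - t₁ with hT
  have hT0 : 0 < T := by rw [hT, ht₁, ht₂]; linarith
  have hsol' : IsClassicalNSSolutionOn (Icc 0 T) 1 0 (fun s => u (s + t₁)) (fun s => q (s + t₁)) := by
    have h := hq.comp_add_right t₁
    refine h.mono (fun s hs => ?_) (uniqueDiffOn_Icc hT0)
    show s + t₁ < 0
    have := hs.2
    rw [hT, ht₂] at this
    linarith
  have hA : ∀ s ∈ Icc 0 T, ∀ (x : EuclideanSpace ℝ (Fin 3)) (r : ℝ), 1 ≤ r →
      ∫ y in ball x r, ‖u (s + t₁) y‖ ^ 2 ≤ C * r := by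
    intro s hs x r hr
    have hs0 : s + t₁ < 0 := by have := hs.2; rw [hT, ht₂] at this; linarith
    exact morrey_of_energyClause h5 hs0 x (by linarith)
  have key := pressure_sub_pressurePotential_eq_morrey zero_le_one hsol' hK.nonneg hA
    (t := t - t₁) ⟨by rw [ht₁]; linarith, by rw [hT, ht₂, ht₁]; linarith⟩ x
  simp only [sub_add_cancel] at key
  linarith

/-- **`D(Q(0,1)) ≤ K_D(C)` for a class member with any classical pressure** — the heart of the
bridge. On a.e. slice `q(t) = Q[u(t)] + c(t)`, so the mean-free quantity sees only `Q[u(t)]`,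
whose oscillation on the unit ball is `≤ K₁ ∫_{B(0,3)}|u(t)|³ + K₂ C^{3/2}`
(`exists_slice_oscillation_bound`) with `∫_{B(0,3)}|u(t)|³ ≤ 3C²(−t)^{−1/2}`; integrate in
`t ∈ (−1,0)` (Tonelli; the mean is continuous in `t`). [cite: AlbrittonBarker2019, §3, Rem. 3.2] -/
theorem exists_cknDOsc_unit_bound :
    ∃ KD : ℝ → ℝ≥0∞, (∀ C, KD C ≠ ⊤) ∧
      ∀ (C : ℝ) (u : ℝ → (EuclideanSpace ℝ (Fin 3)) → (EuclideanSpace ℝ (Fin 3)))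
        (q : ℝ → (EuclideanSpace ℝ (Fin 3)) → ℝ), IsTypeIAncientMild C u →
        (∀ (x₀ : EuclideanSpace ℝ (Fin 3)) (t₀ r : ℝ), t₀ ≤ 0 → 0 < r →
          (∀ t, t₀ - r ^ 2 < t → t < t₀ → r⁻¹ * ∫ x in ball x₀ r, ‖u t x‖ ^ 2 ≤ C) ∧
            r⁻¹ * ∫ t in Ioo (t₀ - r ^ 2) t₀, ∫ x in ball x₀ r, ‖fderiv ℝ (u t) x‖ ^ 2 ≤ C) →
        IsClassicalNSSolutionOn (Iio 0) 1 0 u q → cknDOsc 1 0 q ≤ KD C := by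
  obtain ⟨K₁, K₂, hK₁t, hK₂t, hK⟩ := exists_slice_oscillation_bound
  refine ⟨fun C => K₁ * (ENNReal.ofReal (3 * C ^ 2) * ENNReal.ofReal 2) + K₂ * ENNReal.ofReal C ^ (3 / 2 : ℝ),
    fun C => ENNReal.add_ne_top.2 ⟨ENNReal.mul_ne_top hK₁t (ENNReal.mul_ne_top ENNReal.ofReal_ne_top
      ENNReal.ofReal_ne_top), ENNReal.mul_ne_top hK₂t
        (ENNReal.rpow_ne_top_of_nonneg (by norm_num) ENNReal.ofReal_ne_top)⟩,
    fun C u q hK' h5 hq => ?_⟩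
  have hC0 := hK'.nonneg
  have hqc : ContinuousOn (uncurry q) (Iio (0 : ℝ) ×ˢ univ) := hq.smooth_pressure.continuousOn
  set m : ℝ → ℝ := fun t => ⨍ y in ball (0 : EuclideanSpace ℝ (Fin 3)) 1, q t y with hm
  have hmc : ContinuousOn m (Iio 0) := continuousOn_ballMean hqc
  unfold cknDOsc
  rw [ENNReal.ofReal_one, one_pow, inv_one, one_mul]
  simp only [Prod.snd_zero]
  -- measurability of the integrand and Tonelli
  have hF : AEMeasurable (fun w : ℝ × EuclideanSpace ℝ (Fin 3) => ‖q w.1 w.2 - m w.1‖ₑ ^ (3 / 2 : ℝ))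
      (volume.restrict (parabolicCylinder 1 (0 : ℝ × EuclideanSpace ℝ (Fin 3)))) := by
    refine aemeasurable_parabolicCylinder_one_of_continuousOn ?_
    have hdiff : ContinuousOn (fun w : ℝ × EuclideanSpace ℝ (Fin 3) => q w.1 w.2 - m w.1)
        (Iio (0 : ℝ) ×ˢ univ) :=
      hqc.sub (hmc.comp continuous_fst.continuousOn fun w hw => hw.1)
    exact ENNReal.continuous_rpow_const.comp_continuousOn (continuous_enorm.comp_continuousOn hdiff)
  rw [lintegral_parabolicCylinder_one_eq hF]
  -- the slice bound
  have hslice : ∀ t ∈ Ioo (-1 : ℝ) 0,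
      ∫⁻ x in ball (0 : EuclideanSpace ℝ (Fin 3)) 1, ‖q t x - m t‖ₑ ^ (3 / 2 : ℝ) ≤
        K₁ * (ENNReal.ofReal (3 * C ^ 2) * ENNReal.ofReal ((-t) ^ (-(2⁻¹ : ℝ)))) +
          K₂ * ENNReal.ofReal C ^ (3 / 2 : ℝ) := by
    intro t ht
    have ht0 : t < 0 := ht.2
    have hv4 : ContDiff ℝ 4 (u t) := (hK'.contDiff_slice ht0).of_le (by norm_cast)
    have hA : ∀ (x : EuclideanSpace ℝ (Fin 3)) (r : ℝ), 1 ≤ r → ∫ y in ball x r, ‖u t y‖ ^ 2 ≤ C * r :=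
      fun x r hr => morrey_of_energyClause h5 ht0 x (by linarith)
    set Q := pressurePotential (u t) with hQ
    -- `q(t) − (q(t))_{B} = Q − (Q)_B`
    obtain ⟨c, hc⟩ : ∃ c : ℝ, ∀ x, q t x = Q x + c :=
      ⟨q t 0 - Q 0, fun x => pressure_eq_pressurePotential_add hK' h5 hq ht0 x⟩
    have hQc : Continuous Q := (contDiff_pressurePotential_morrey hv4 hA).continuous
    have hV0 : volume (ball (0 : EuclideanSpace ℝ (Fin 3)) 1) ≠ 0 := (measure_ball_pos volume _ one_pos).ne'
    have hVt : volume (ball (0 : EuclideanSpace ℝ (Fin 3)) 1) ≠ ⊤ := measure_ball_lt_top.ne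
    have hmean : m t = (⨍ y in ball (0 : EuclideanSpace ℝ (Fin 3)) 1, Q y) + c := by
      have hQi : IntegrableOn Q (ball (0 : EuclideanSpace ℝ (Fin 3)) 1) volume :=
        (hQc.continuousOn.integrableOn_compact (isCompact_closedBall 0 1)).mono_set ball_subset_closedBall
      have e : (fun y => q t y) = fun y => Q y + c := funext hc
      rw [hm]
      dsimp only
      rw [e, setAverage_eq, setAverage_eq, integral_add hQi (integrableOn_const hVt), setIntegral_const,
        smul_eq_mul, smul_eq_mul, smul_eq_mul, mul_add]
      have hreal : volume.real (ball (0 : EuclideanSpace ℝ (Fin 3)) 1) ≠ 0 :=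
        (ENNReal.toReal_pos hV0 hVt).ne'
      congr 1
      field_simp
    have hptw : ∀ x, ‖q t x - m t‖ₑ ^ (3 / 2 : ℝ) =
        ‖Q x - ⨍ y in ball (0 : EuclideanSpace ℝ (Fin 3)) 1, Q y‖ₑ ^ (3 / 2 : ℝ) := fun x => by
      rw [hc x, hmean]
      congr 2
      ring
    simp only [hptw]
    refine (hK (u t) C hv4 hA).trans ?_
    gcongr
    · -- `∫_{B(0,3)} |u(t)|³ ≤ 3C² (−t)^{−1/2}`
      have hA3 := hA 0 3 (by norm_num)
      refine (lintegral_ball_cube_le hK' ht0 0 3).trans ?_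
      have hpow : 0 ≤ (-t) ^ (-(2⁻¹ : ℝ)) := Real.rpow_nonneg (by linarith) _
      rw [lintegral_ball_enorm_sq_eq (hK'.continuous_slice ht0), ← ENNReal.ofReal_mul (mul_nonneg hC0 hpow),
        ← ENNReal.ofReal_mul (by positivity : (0:ℝ) ≤ 3 * C ^ 2)]
      refine ENNReal.ofReal_le_ofReal ?_
      calc C * (-t) ^ (-(2⁻¹ : ℝ)) * ∫ x in ball (0 : EuclideanSpace ℝ (Fin 3)) 3, ‖u t x‖ ^ 2
          ≤ C * (-t) ^ (-(2⁻¹ : ℝ)) * (C * 3) := mul_le_mul_of_nonneg_left hA3 (by positivity)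
        _ = 3 * C ^ 2 * (-t) ^ (-(2⁻¹ : ℝ)) := by ring
  -- integrate in time
  have hmeas : Measurable fun t : ℝ => K₁ * (ENNReal.ofReal (3 * C ^ 2) * ENNReal.ofReal ((-t) ^ (-(2⁻¹ : ℝ)))) :=
    ((measurable_neg.pow_const _).ennreal_ofReal.const_mul _).const_mul _
  calc ∫⁻ t in Ioo (-1 : ℝ) 0, ∫⁻ x in ball (0 : EuclideanSpace ℝ (Fin 3)) 1, ‖q t x - m t‖ₑ ^ (3 / 2 : ℝ)
      ≤ ∫⁻ t in Ioo (-1 : ℝ) 0, (K₁ * (ENNReal.ofReal (3 * C ^ 2) * ENNReal.ofReal ((-t) ^ (-(2⁻¹ : ℝ)))) +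
          K₂ * ENNReal.ofReal C ^ (3 / 2 : ℝ)) := setLIntegral_mono' measurableSet_Ioo hslice
    _ = K₁ * (ENNReal.ofReal (3 * C ^ 2) * ∫⁻ t in Ioo (-1 : ℝ) 0, ENNReal.ofReal ((-t) ^ (-(2⁻¹ : ℝ)))) +
          K₂ * ENNReal.ofReal C ^ (3 / 2 : ℝ) * volume (Ioo (-1 : ℝ) 0) := by
        rw [lintegral_add_left hmeas, setLIntegral_const, lintegral_const_mul' _ _ hK₁t,
          lintegral_const_mul' _ _ ENNReal.ofReal_ne_top]
    _ ≤ K₁ * (ENNReal.ofReal (3 * C ^ 2) * ENNReal.ofReal 2) + K₂ * ENNReal.ofReal C ^ (3 / 2 : ℝ) * 1 := by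
        gcongr
        · exact lintegral_Ioo_rpow_neg_half_le
        · rw [Real.volume_Ioo]; norm_num
    _ = _ := by rw [mul_one]

/-- **`𝐈(ℝ³ × ℝ₋) < ∞` for every member of the Type-I model class 𝒦_C** (with any classical
pressure `q` and `∇u := fderiv`): every admissible ball `Q(z, r)` of the slab is the unit ball of
the zoom about `(z.1, z.2)` with factor `r`, which is again a class member with a classical
pressure (`modelClass_zoom`); on the unit ball `A ≤ C`, `C ≤ 2C²`, `D ≤ K_D(C)`, `E ≤ 3C`, and the
four quantities are scale-covariant (`abScaledSum_nsZoom`). [cite: AlbrittonBarker2019, §1 and Rem. 3.2] -/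
theorem typeIBound_slab_lt_top (hK : IsTypeIAncientMild C u)
    (h5 : ∀ (x₀ : EuclideanSpace ℝ (Fin 3)) (t₀ r : ℝ), t₀ ≤ 0 → 0 < r →
      (∀ t, t₀ - r ^ 2 < t → t < t₀ → r⁻¹ * ∫ x in ball x₀ r, ‖u t x‖ ^ 2 ≤ C) ∧
        r⁻¹ * ∫ t in Ioo (t₀ - r ^ 2) t₀, ∫ x in ball x₀ r, ‖fderiv ℝ (u t) x‖ ^ 2 ≤ C)
    (hq : IsClassicalNSSolutionOn (Iio 0) 1 0 u q) :
    typeIBound (Iio (0 : ℝ) ×ˢ univ) u q (fun t x => fderiv ℝ (u t) x) < ⊤ := by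
  obtain ⟨KD, hKDt, hKD⟩ := exists_cknDOsc_unit_bound
  set K : ℝ≥0∞ := ENNReal.ofReal C + ENNReal.ofReal (2 * C ^ 2) + KD C + ENNReal.ofReal (3 * C) with hKdef
  have hKt : K < ⊤ := by
    rw [hKdef, lt_top_iff_ne_top]
    exact ENNReal.add_ne_top.2 ⟨ENNReal.add_ne_top.2 ⟨ENNReal.add_ne_top.2
      ⟨ENNReal.ofReal_ne_top, ENNReal.ofReal_ne_top⟩, hKDt C⟩, ENNReal.ofReal_ne_top⟩
  refine lt_of_le_of_lt (typeIBound_le_iff.2 fun r hr z hz => ?_) hKt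
  -- a parabolic ball inside the backward slab has a non-positive top time
  have ht₀ : z.1 ≤ 0 := by
    by_contra hz0
    push Not at hz0
    have hε1 : min (r ^ 2 / 2) (z.1 / 2) ≤ r ^ 2 / 2 := min_le_left _ _
    have hε2 : min (r ^ 2 / 2) (z.1 / 2) ≤ z.1 / 2 := min_le_right _ _
    have hε0 : 0 < min (r ^ 2 / 2) (z.1 / 2) := lt_min (by positivity) (by linarith)
    have hw : (z.1 - min (r ^ 2 / 2) (z.1 / 2), z.2) ∈ parabolicCylinder r z := by
      rw [mem_parabolicCylinder]
      exact ⟨⟨by dsimp only; nlinarith [sq_nonneg r], by dsimp only; linarith⟩, by simpa using hr⟩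
    have : z.1 - min (r ^ 2 / 2) (z.1 / 2) < 0 := (hz hw).1
    linarith
  obtain ⟨hK', h5', hq'⟩ := modelClass_zoom hK h5 hq hr ht₀ z.2
  set G : ℝ → (EuclideanSpace ℝ (Fin 3)) → (EuclideanSpace ℝ (Fin 3)) →L[ℝ] (EuclideanSpace ℝ (Fin 3)) :=
    fun t x => fderiv ℝ (u t) x with hG
  -- the ball `Q(z, r)` is the unit ball of the zoom
  have e0 : stAffine (r ^ 2) r z.1 z.2 (0 : ℝ × EuclideanSpace ℝ (Fin 3)) = z := by
    ext <;> simp [stAffine_fst, stAffine_snd]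
  have hsum := abScaledSum_nsZoom hr one_pos z.1 z.2 (0 : ℝ × EuclideanSpace ℝ (Fin 3)) u q G
  rw [mul_one, e0] at hsum
  rw [← hsum]
  -- the zoomed gradient is the gradient of the zoom on the unit ball
  have hE : cknE 1 0 ((r ^ 2) • stPull (r ^ 2) r z.1 z.2 G) =
      cknE 1 0 (fun s y => fderiv ℝ ((r • stPull (r ^ 2) r z.1 z.2 u) s) y) := by
    refine cknE_congr_on fun w hw => ?_
    rw [mem_parabolicCylinder] at hw
    have hs : w.1 < 0 := by simpa using hw.1.2
    have hneg : z.1 + r ^ 2 * w.1 < 0 := by nlinarith [mul_pos (pow_pos hr 2) (neg_pos.2 hs)]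
    have hd : Differentiable ℝ (u (z.1 + r ^ 2 * w.1)) :=
      (hK.contDiff_slice hneg).differentiable (by simp)
    rw [fderiv_zoom_center z.2 u hd w.2, hG]
    simp [stPull_apply]
  unfold abScaledSum
  rw [hE]
  calc cknAEss 1 0 (r • stPull (r ^ 2) r z.1 z.2 u) + cknC 1 0 (r • stPull (r ^ 2) r z.1 z.2 u) +
        cknDOsc 1 0 ((r ^ 2) • stPull (r ^ 2) r z.1 z.2 q) +
        cknE 1 0 (fun s y => fderiv ℝ ((r • stPull (r ^ 2) r z.1 z.2 u) s) y)
      ≤ ENNReal.ofReal C + ENNReal.ofReal (2 * C ^ 2) + KD C + ENNReal.ofReal (3 * C) :=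
        add_le_add (add_le_add (add_le_add (cknAEss_unit_le hK' h5') (cknC_unit_le hK' h5'))
          (hKD C _ _ hK' h5' hq')) (cknE_unit_le hK' h5')
    _ = K := by rw [hKdef]

end Summit.NavierStokesRegularity.NavierStokesRegularity.Theorems.SingularProfile
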